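import Mathlib
import Summits.Ventures.HodgeRepro2.T6N1WitBasis

/-!
# T6N1WitGram — the pair monomials of `⋀²U`, their conjugates and products, the dictionary `sc` and the
Gram functional `λ₂` (the non-degenerate N1 instance, STATUS l. 11284 (S4)–(S5); owner t6-p1, gen 3)

In the adapted monomial basis `e_S` of `⋀(V × V)` (T6N1WitBasis), the subspace `H20 = H10 · H10` is spanned
by the pair monomials `e_p`, `p` a 2-subset of the `U`-indices; `conj2 e_q = d_q • e_{C q}` and
`e_p · conj2 e_q = s(p, q) • e_{p ∪ C q}` with non-zero scalars (`conj2_eS_pair`, `prod_eS`), the index map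
`(p, q) ↦ p ∪ C q` being injective (`SPQ_injective`). The dictionary `sc : ⋀(V × V) →ₗ ℓ²` sends the
first-copy pairs to orthonormal vectors and the second-copy pairs to the adjoint of the block
`(p, q) ↦ λ₁(e_p · conj2 e_q)` (the only block where the projection formula speaks); `λ₂` is the Gram
functional on the remaining pair products. The monomial case of the Petersson display,
`(λ₁ + λ₂)(e_p · conj2 e_q) = ⟪sc e_q, sc e_p⟫`, is `intS_eS_pair` of T6N1WitGram2. No `sorry`; standard axioms.
§8(d): uses an L-value-free non-vanishing device: NO.
-/

namespace Summit.Ventures.HodgeRepro2.T6.N1Wit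

open ExteriorAlgebra Conj Set.powersetCard
open scoped InnerProductSpace

variable {K : Type} [Field K] [NumberField K] {F : FaceSetting K} (D : WitData F)

namespace WitData

/-! ## 1. Monomials -/

/-- The monomials `e_S` of the adapted basis. -/
noncomputable abbrev eS (S : Finset (Fin (nJ K))) : HS2 K := D.bI.ExteriorAlgebra S

/-- `e_S` as an iterated wedge of the sorted basis vectors. -/
theorem eS_eq (S : Finset (Fin (nJ K))) :
    D.eS S = ιMulti ℂ S.card (D.bI ∘ S.orderEmbOfFin rfl) := by
  rw [eS, ExteriorAlgebra.basis_apply_ofCard D.bI rfl]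
  rfl

/-- `e_{a} = ι (b a)`. -/
theorem eS_singleton (a : Fin (nJ K)) : D.eS {a} = ι ℂ (D.bI a) := by
  rw [eS, ExteriorAlgebra.basis_apply_ofCard D.bI (Finset.card_singleton a)]
  show ιMulti ℂ 1 (D.bI ∘ (ofFinEmbEquiv.symm (ofCard (Finset.card_singleton a)))) = _
  rw [ιMulti_succ_apply, ιMulti_zero_apply, mul_one]
  simp [ofFinEmbEquiv_symm_apply]

/-- Disjoint monomials multiply to a sign times the union monomial. -/
theorem eS_mul_eS_of_disjoint {S T : Finset (Fin (nJ K))} (h : Disjoint S T) :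
    ∃ u : ℤˣ, D.eS S * D.eS T = u • D.eS (S ∪ T) := by
  let s : Set.powersetCard (Fin (nJ K)) S.card := ofCard rfl
  let t : Set.powersetCard (Fin (nJ K)) T.card := ofCard rfl
  have h' : Disjoint s.val t.val := h
  refine ⟨(permOfDisjoint h').sign, ?_⟩
  have := ExteriorAlgebra.basis_mul_of_disjoint D.bI s t h'
  rw [coe_disjUnion, Finset.disjUnion_eq_union] at this
  exact this

/-- A unit of `ℤ` acting on `HS2 K` is a non-zero complex scalar. -/
theorem units_smul_eq (u : ℤˣ) (x : HS2 K) : u • x = ((u : ℤ) : ℂ) • x := by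
  rw [Units.smul_def, ← Int.cast_smul_eq_zsmul ℂ]

/-- `conj2` of a monomial pair `e_{a,b}` is a non-zero multiple of `e_{C a, C b}`. -/
theorem conj2_eS_pair {a b : Fin (nJ K)} (hab : a ≠ b) :
    ∃ d : ℂ, d ≠ 0 ∧ conj2 (D.eS {a, b}) = d • D.eS {Cidx K a, Cidx K b} := by
  obtain ⟨u, hu⟩ := D.eS_mul_eS_of_disjoint (Finset.disjoint_singleton.2 hab)
  obtain ⟨u', hu'⟩ := D.eS_mul_eS_of_disjoint
    (Finset.disjoint_singleton.2 (Cidx_injective.ne hab))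
  obtain ⟨ca, hca0, hca⟩ := D.exists_swapConj_bI a
  obtain ⟨cb, hcb0, hcb⟩ := D.exists_swapConj_bI b
  have hunit : ((u : ℤ) : ℂ) ≠ 0 := by exact_mod_cast u.ne_zero
  have hunit' : ((u' : ℤ) : ℂ) ≠ 0 := by exact_mod_cast u'.ne_zero
  refine ⟨((u : ℤ) : ℂ)⁻¹ * ca * cb * ((u' : ℤ) : ℂ),
    mul_ne_zero (mul_ne_zero (mul_ne_zero (inv_ne_zero hunit) hca0) hcb0) hunit', ?_⟩
  rw [Finset.insert_eq, Finset.insert_eq]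
  have h1 : D.eS ({a} ∪ {b}) = ((u : ℤ) : ℂ)⁻¹ • (D.eS {a} * D.eS {b}) := by
    rw [hu, units_smul_eq, inv_smul_smul₀ hunit]
  rw [h1, conj2_smul, map_inv₀, map_intCast, map_mul, D.eS_singleton, D.eS_singleton, conj2_ι,
    conj2_ι, hca, hcb, map_smul, map_smul, smul_mul_smul_comm, ← D.eS_singleton, ← D.eS_singleton,
    hu', units_smul_eq, smul_smul, smul_smul]
  congr 1
  ring

/-! ## 2. The pair monomials of `⋀²U` and their products with conjugates -/

/-- The `U`-pairs: 2-subsets of the `U`-indices. -/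
noncomputable def pairs (F : FaceSetting K) : Finset (Finset (Fin (nJ K))) := (IU F).powersetCard 2

/-- Membership in `pairs`. -/
theorem mem_pairs {p : Finset (Fin (nJ K))} : p ∈ pairs F ↔ p ⊆ IU F ∧ p.card = 2 :=
  Finset.mem_powersetCard

/-- The index swap on finsets. -/
noncomputable def Cset (S : Finset (Fin (nJ K))) : Finset (Fin (nJ K)) := S.image (Cidx K)

/-- `Cset` is injective. -/
theorem Cset_injective : Function.Injective (Cset (K := K)) :=
  Finset.image_injective Cidx_injective

/-- `Cset` of a pair. -/
theorem Cset_pair (a b : Fin (nJ K)) : Cset {a, b} = {Cidx K a, Cidx K b} := by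
  simp [Cset, Finset.image_insert, Finset.image_singleton]

/-- `Cset` of a `U`-subset is disjoint from the `U`-indices. -/
theorem Cset_disjoint_IU {q : Finset (Fin (nJ K))} (hq : q ⊆ IU F) : Disjoint (Cset q) (IU F) := by
  rw [Finset.disjoint_left]
  intro x hx hxU
  obtain ⟨y, hy, rfl⟩ := Finset.mem_image.1 hx
  exact (Cidx_mem_IU_iff y).1 hxU (hq hy)

/-- `conj2 e_q = d • e_{C q}` for a `U`-pair `q`. -/
theorem conj2_eS_of_mem_pairs {q : Finset (Fin (nJ K))} (hq : q ∈ pairs F) :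
    ∃ d : ℂ, d ≠ 0 ∧ conj2 (D.eS q) = d • D.eS (Cset q) := by
  obtain ⟨a, b, hab, rfl⟩ := Finset.card_eq_two.1 (mem_pairs.1 hq).2
  rw [Cset_pair]
  exact D.conj2_eS_pair hab

/-- `e_p · conj2 e_q = s • e_{p ∪ C q}`, `s ≠ 0`, for `U`-pairs `p`, `q`. -/
theorem prod_eS {p q : Finset (Fin (nJ K))} (hp : p ∈ pairs F) (hq : q ∈ pairs F) :
    ∃ s : ℂ, s ≠ 0 ∧ D.eS p * conj2 (D.eS q) = s • D.eS (p ∪ Cset q) := by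
  obtain ⟨d, hd0, hd⟩ := D.conj2_eS_of_mem_pairs hq
  have hdisj : Disjoint p (Cset q) :=
    (Cset_disjoint_IU (mem_pairs.1 hq).1).symm.mono_left (mem_pairs.1 hp).1
  obtain ⟨u, hu⟩ := D.eS_mul_eS_of_disjoint hdisj
  have hunit : ((u : ℤ) : ℂ) ≠ 0 := by exact_mod_cast u.ne_zero
  refine ⟨d * ((u : ℤ) : ℂ), mul_ne_zero hd0 hunit, ?_⟩
  rw [hd, mul_smul_comm, hu, units_smul_eq, smul_smul]

/-- `S(p, q) := p ∪ C q`. -/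
noncomputable def SPQ (p q : Finset (Fin (nJ K))) : Finset (Fin (nJ K)) := p ∪ Cset q

/-- `(p, q) ↦ p ∪ C q` is injective on `U`-pairs. -/
theorem SPQ_injective {p q p' q' : Finset (Fin (nJ K))} (hp : p ∈ pairs F) (hq : q ∈ pairs F)
    (hp' : p' ∈ pairs F) (hq' : q' ∈ pairs F) (h : SPQ p q = SPQ p' q') : p = p' ∧ q = q' := by
  have key : ∀ {p q : Finset (Fin (nJ K))}, p ∈ pairs F → q ∈ pairs F →
      (SPQ p q).filter (· ∈ IU F) = p ∧ (SPQ p q).filter (· ∉ IU F) = Cset q := by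
    intro p q hp hq
    have hpU := (mem_pairs.1 hp).1
    have hdisj := Cset_disjoint_IU (F := F) (mem_pairs.1 hq).1
    constructor
    · ext x
      simp only [SPQ, Finset.mem_filter, Finset.mem_union]
      constructor
      · rintro ⟨hx | hx, hxU⟩
        · exact hx
        · exact absurd hxU (Finset.disjoint_left.1 hdisj hx)
      · intro hx; exact ⟨Or.inl hx, hpU hx⟩
    · ext x
      simp only [SPQ, Finset.mem_filter, Finset.mem_union]
      constructor
      · rintro ⟨hx | hx, hxU⟩
        · exact absurd (hpU hx) hxU
        · exact hx
      · intro hx; exact ⟨Or.inr hx, Finset.disjoint_left.1 hdisj hx⟩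
  obtain ⟨h1, h2⟩ := key hp hq
  obtain ⟨h1', h2'⟩ := key hp' hq'
  refine ⟨?_, Cset_injective ?_⟩
  · rw [← h1, ← h1', h]
  · rw [← h2, ← h2', h]

/-! ## 3. Coordinates, and `λ₁` on monomials -/

/-- The coordinate functionals of the monomial basis. -/
noncomputable abbrev coordS (T : Finset (Fin (nJ K))) : HS2 K →ₗ[ℂ] ℂ := D.bI.ExteriorAlgebra.coord T

/-- The coordinates of a monomial. -/
theorem coordS_eS (T S : Finset (Fin (nJ K))) : D.coordS T (D.eS S) = if T = S then 1 else 0 := by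
  simp only [coordS, eS, Module.Basis.coord_apply, Module.Basis.repr_self, Finsupp.single_apply]
  by_cases h : S = T
  · subst h; simp
  · rw [if_neg h, if_neg (Ne.symm h)]

/-- `s(p, q)`: the coordinate of `e_p · conj2 e_q` on `e_{S(p, q)}`. -/
noncomputable def sPQ (p q : Finset (Fin (nJ K))) : ℂ := D.coordS (SPQ p q) (D.eS p * conj2 (D.eS q))

/-- `e_p · conj2 e_q = s(p, q) • e_{S(p, q)}`. -/
theorem prod_eS_eq_sPQ_smul {p q : Finset (Fin (nJ K))} (hp : p ∈ pairs F) (hq : q ∈ pairs F) :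
    D.eS p * conj2 (D.eS q) = D.sPQ p q • D.eS (SPQ p q) := by
  obtain ⟨s, -, hs⟩ := D.prod_eS hp hq
  have h1 : D.sPQ p q = s := by
    rw [sPQ, SPQ, hs, map_smul, coordS_eS, if_pos rfl, smul_eq_mul, mul_one]
  rw [h1, SPQ, hs]

/-- `s(p, q) ≠ 0`. -/
theorem sPQ_ne_zero {p q : Finset (Fin (nJ K))} (hp : p ∈ pairs F) (hq : q ∈ pairs F) :
    D.sPQ p q ≠ 0 := by
  obtain ⟨s, hs0, hs⟩ := D.prod_eS hp hq
  rw [sPQ, SPQ, hs, map_smul, coordS_eS, if_pos rfl, smul_eq_mul, mul_one]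
  exact hs0

open Classical in
/-- The first-copy indices. -/
noncomputable def Iinl (K : Type) [Field K] [NumberField K] : Finset (Fin (nJ K)) :=
  Finset.univ.filter fun a => ((idx K).symm a).isLeft = true

/-- `idx (inl j) ∈ Iinl`. -/
theorem idx_inl_mem_Iinl (j : Fin 4 × (K →+* ℂ)) : idx K (Sum.inl j) ∈ Iinl K := by
  simp [Iinl]

/-- `idx (inr j) ∉ Iinl`. -/
theorem idx_inr_notMem_Iinl (j : Fin 4 × (K →+* ℂ)) : idx K (Sum.inr j) ∉ Iinl K := by
  simp [Iinl]

/-- An index outside `Iinl` is a second-copy index. -/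
theorem exists_inr_of_notMem_Iinl {a : Fin (nJ K)} (ha : a ∉ Iinl K) :
    ∃ j, a = idx K (Sum.inr j) := by
  obtain ⟨j, rfl⟩ := (idx K).surjective a
  rcases j with j | j
  · exact absurd (idx_inl_mem_Iinl j) ha
  · exact ⟨j, rfl⟩

/-- The swap exchanges the two copies. -/
theorem Cidx_mem_Iinl_iff (a : Fin (nJ K)) : Cidx K a ∈ Iinl K ↔ a ∉ Iinl K := by
  obtain ⟨j, rfl⟩ := (idx K).surjective a
  rcases j with j | j
  · simp [Cidx, Cj, Iinl]
  · simp [Cidx, Cj, Iinl]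

/-- `λ₁` kills every monomial meeting the second copy. -/
theorem lam1_eS_of_not_subset {w : KC K} (hw0 : w ≠ 0) {S : Finset (Fin (nJ K))}
    (hS : ¬ S ⊆ Iinl K) : lam1 hw0 (D.eS S) = 0 := by
  obtain ⟨a, haS, ha⟩ := Finset.not_subset.1 hS
  obtain ⟨j, rfl⟩ := exists_inr_of_notMem_Iinl ha
  have hrange : idx K (Sum.inr j) ∈ Set.range (S.orderEmbOfFin rfl) := by
    rw [Finset.range_orderEmbOfFin]; exact haS
  obtain ⟨i, hi⟩ := hrange
  rw [D.eS_eq]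
  simp only [lam1, LinearMap.comp_apply, AlgHom.toLinearMap_apply, ExteriorAlgebra.map_apply_ιMulti]
  rw [AlternatingMap.map_coord_zero _ i]
  · exact map_zero _
  · simp only [Function.comp_apply, hi]
    obtain ⟨i', σ'⟩ := j
    rw [D.bI_inr]
    rfl

/-! ## 4. The dictionary `sc` and the Gram functional `λ₂` -/

/-- The automorphic space of the witness: `ℓ²` on the finsets of indices. -/
abbrev LGw (K : Type) [Field K] [NumberField K] : Type := EuclideanSpace ℂ (Finset (Fin (nJ K)))

/-- The orthonormal vectors `f_p`. -/
noncomputable def fvec (p : Finset (Fin (nJ K))) : LGw K := EuclideanSpace.single p (1 : ℂ)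

/-- Orthonormality of the `f_p`. -/
theorem inner_fvec (p q : Finset (Fin (nJ K))) : ⟪fvec p, fvec q⟫_ℂ = if p = q then 1 else 0 := by
  simp [fvec, EuclideanSpace.inner_single_left]

open Classical in
/-- The first-copy pairs. -/
noncomputable def pairs1 (F : FaceSetting K) : Finset (Finset (Fin (nJ K))) :=
  (pairs F).filter fun p => p ⊆ Iinl K

open Classical in
/-- The second-copy pairs. -/
noncomputable def pairs3 (F : FaceSetting K) : Finset (Finset (Fin (nJ K))) :=
  (pairs F).filter fun q => Disjoint q (Iinl K)

open Classical in
/-- The values of `sc` on the monomials: `f_p` on first-copy pairs, the adjoint of the block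
`λ₁(e_p · conj2 e_q)` on second-copy pairs, `0` elsewhere. -/
noncomputable def scVal {w : KC K} (hw0 : w ≠ 0) (S : Finset (Fin (nJ K))) : LGw K :=
  if S ∈ pairs1 F then fvec S
  else if S ∈ pairs3 F then
    ∑ p ∈ pairs1 F, (starRingEnd ℂ (lam1 hw0 (D.eS p * conj2 (D.eS S)))) • fvec p
  else 0

/-- THE DICTIONARY `sc`. -/
noncomputable def sc {w : KC K} (hw0 : w ≠ 0) : HS2 K →ₗ[ℂ] LGw K :=
  D.bI.ExteriorAlgebra.constr ℂ (D.scVal hw0)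

/-- `sc` on monomials. -/
theorem sc_eS {w : KC K} (hw0 : w ≠ 0) (S : Finset (Fin (nJ K))) : D.sc hw0 (D.eS S) = D.scVal hw0 S :=
  Module.Basis.constr_basis _ _ _ _

open Classical in
/-- The raw Gram functional: on the pair products `e_p · conj2 e_q` not contained in the first copy,
the value `⟪sc e_q, sc e_p⟫`. -/
noncomputable def lam2raw {w : KC K} (hw0 : w ≠ 0) : HS2 K →ₗ[ℂ] ℂ :=
  ∑ p ∈ pairs F, ∑ q ∈ pairs F,
    if SPQ p q ⊆ Iinl K then 0
    else (⟪D.sc hw0 (D.eS q), D.sc hw0 (D.eS p)⟫_ℂ / D.sPQ p q) • D.coordS (SPQ p q)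

/-- The linear projection `(x, y) ↦ (x, 0)` of `V × V` onto the first copy. -/
noncomputable def piL (K : Type) [Field K] [NumberField K] : V2 K →ₗ[ℂ] V2 K :=
  LinearMap.inl ℂ (H1C K) (H1C K) ∘ₗ LinearMap.fst ℂ (H1C K) (H1C K)

/-- `piL (x, y) = (x, 0)`. -/
theorem piL_apply (p : V2 K) : piL K p = (p.1, 0) := rfl

/-- The projection of `⋀(V × V)` onto the first copy: `⋀(piL)`. -/
noncomputable def projL (K : Type) [Field K] [NumberField K] : HS2 K →ₐ[ℂ] HS2 K :=
  ExteriorAlgebra.map (piL K)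

/-- `projL ∘ f^* = f^*`. -/
theorem projL_pull2 (x : HBC K) : projL K (pull2 x) = pull2 x := by
  have h := congrArg (fun f : HBC K →ₐ[ℂ] HS2 K => f x)
    (ExteriorAlgebra.map_comp_map (LinearMap.inl ℂ (H1C K) (H1C K)) (piL K))
  simp only [AlgHom.comp_apply] at h
  have hcomp : piL K ∘ₗ LinearMap.inl ℂ (H1C K) (H1C K) = LinearMap.inl ℂ (H1C K) (H1C K) := by
    ext v <;> rfl
  rw [projL, pull2, h, hcomp]

/-- A first-copy index is `idx (inl j)`. -/
theorem exists_inl_of_mem_Iinl {a : Fin (nJ K)} (ha : a ∈ Iinl K) : ∃ j, a = idx K (Sum.inl j) := by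
  obtain ⟨j, rfl⟩ := (idx K).surjective a
  rcases j with j | j
  · exact ⟨j, rfl⟩
  · exact absurd ha (idx_inr_notMem_Iinl j)

/-- `piL` fixes the first-copy basis vectors. -/
theorem piL_bI_of_mem {a : Fin (nJ K)} (ha : a ∈ Iinl K) : piL K (D.bI a) = D.bI a := by
  obtain ⟨⟨i, σ⟩, rfl⟩ := exists_inl_of_mem_Iinl ha
  rw [D.bI_inl, piL_apply]

/-- `piL` kills the second-copy basis vectors. -/
theorem piL_bI_of_notMem {a : Fin (nJ K)} (ha : a ∉ Iinl K) : piL K (D.bI a) = 0 := by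
  obtain ⟨⟨i, σ⟩, rfl⟩ := exists_inr_of_notMem_Iinl ha
  rw [D.bI_inr, piL_apply]
  rfl

/-- `projL` fixes the first-copy monomials. -/
theorem projL_eS_of_subset {S : Finset (Fin (nJ K))} (hS : S ⊆ Iinl K) : projL K (D.eS S) = D.eS S := by
  rw [D.eS_eq, projL, ExteriorAlgebra.map_apply_ιMulti]
  congr 1
  funext i
  simp only [Function.comp_apply]
  exact D.piL_bI_of_mem (hS (Finset.orderEmbOfFin_mem S rfl i))

/-- `projL` kills the monomials meeting the second copy. -/
theorem projL_eS_of_not_subset {S : Finset (Fin (nJ K))} (hS : ¬ S ⊆ Iinl K) : projL K (D.eS S) = 0 := by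
  obtain ⟨a, haS, ha⟩ := Finset.not_subset.1 hS
  have hrange : a ∈ Set.range (S.orderEmbOfFin rfl) := by
    rw [Finset.range_orderEmbOfFin]; exact haS
  obtain ⟨i, hi⟩ := hrange
  rw [D.eS_eq, projL, ExteriorAlgebra.map_apply_ιMulti]
  refine AlternatingMap.map_coord_zero _ i ?_
  simp only [Function.comp_apply, hi]
  exact D.piL_bI_of_notMem ha

/-- THE GRAM FUNCTIONAL `λ₂ := λ₂raw ∘ (id - projL)`: vanishes on the first copy by construction. -/
noncomputable def lam2 {w : KC K} (hw0 : w ≠ 0) : HS2 K →ₗ[ℂ] ℂ :=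
  D.lam2raw hw0 ∘ₗ (LinearMap.id - (projL K).toLinearMap)

/-- `λ₂` vanishes on the image of `f^*`. -/
theorem lam2_pull2 {w : KC K} (hw0 : w ≠ 0) (x : HBC K) : D.lam2 hw0 (pull2 x) = 0 := by
  simp only [lam2, LinearMap.comp_apply, LinearMap.sub_apply, LinearMap.id_apply, AlgHom.toLinearMap_apply,
    projL_pull2, sub_self, map_zero]

/-- `λ₂` on monomials: `λ₂raw` off the first copy, `0` on it. -/
theorem lam2_eS {w : KC K} (hw0 : w ≠ 0) (S : Finset (Fin (nJ K))) :
    D.lam2 hw0 (D.eS S) = if S ⊆ Iinl K then 0 else D.lam2raw hw0 (D.eS S) := by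
  simp only [lam2, LinearMap.comp_apply, LinearMap.sub_apply, LinearMap.id_apply, AlgHom.toLinearMap_apply]
  split_ifs with h
  · rw [D.projL_eS_of_subset h, sub_self, map_zero]
  · rw [D.projL_eS_of_not_subset h, sub_zero]

end WitData

end Summit.Ventures.HodgeRepro2.T6.N1Wit
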